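import Summits.ValiantsHypothesis.ValiantsHypothesis.Theorems.DepthWindowBDSCore
import Summits.ValiantsHypothesis.ValiantsHypothesis.Theorems.DepthWindowBDSFit
import Summits.ValiantsHypothesis.ValiantsHypothesis.Theorems.DepthWindowSlopeRate
import HarnessLib

/-!
# Route `DepthWindow` — the hard side of the slope–rate dial up to slope `7/5` (item `HomImmHardSubReach`)

Closing file of the support item `HomImmHardSubReach` of `Theses/DepthWindow.lean` (decomp-valiant workshop, lens 4,
generation 10; port plan `PLAN-w2` F5′): the Bhargav–Dutta–Saxena golden-ratio depth hierarchy for HOMOGENEOUS circuits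
computing `IMM_{m,⌊√⌊log₂ m⌋⌋}` over `ℂ`, at every depth slope `p/q ≤ 7/5 < 1/log₂ φ ≈ 1.4404`.  The work is in the
cone-free helpers: `DepthWindowBDSSequences/Law/Fit.lean` (continued-fraction thresholds and the imbalance law),
`Literature/…/GenWord*.lean` (word polynomials over an arbitrary word), `DepthWindowGenFlatRank.lean` (law-driven rank
induction), `DepthWindowBDSBound.lean` (`homBds`), `DepthWindowBDSCore.lean` (`homBds_core`); this file only plugs in
`BDS.fit` and the slope bookkeeping of `DepthWindowSlopeRate.lean`.

* `homImmHardAt_seven_five : HomImmHardAt 7 5`;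
* `homImmHardAt_of_five_mul_le : 5 p ≤ 7 q → HomImmHardAt p q` (down-set in the slope, `q = 0` corner included);
* `homImmHardSubReach_bds : HomImmHardSubReach` — the item, PRINT → KERNEL.

Unconditional, 0 sorry, def-free.  Rung currency only: this is the known (BDS 2024) hard column of the dial; the
crux `HomSubReach` (homogenisation at slope `≤ 7/5`) and the residual `CollapseLog3` are untouched, and nothing here
bears on `VP ≠ VNP` itself.

References: [BhargavDuttaSaxena2024] Thm 1.4, Rem. 1.5; [LimayeSrinivasanTavenas2025] Lemma 12.
-/

-- layout Summits/ValiantsHypothesis/ValiantsHypothesis forces the duplicated namespace component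
set_option linter.dupNamespace false

namespace Summit.ValiantsHypothesis.ValiantsHypothesis.Theorems.DepthWindow

open MvPolynomial Literature.Computability.AlgebraicComplexity ArithCircuit
open Summit.ValiantsHypothesis.ValiantsHypothesis.Theses.DepthWindow

noncomputable section

/-- **Hard(7/5)**: homogeneous circuits (all gate values homogeneous) of product-depth
`≤ ⌊7 ⌊log₂⌊log₂⌊log₂ m⌋⌋⌋/5⌋ + c` for `IMM_{m,⌊√⌊log₂ m⌋⌋}` over `ℂ` have size `> m^c + c` for all large `m` — the
Bhargav–Dutta–Saxena golden-ratio hierarchy at slope `7/5 < 1/log₂ φ`. [cite: BhargavDuttaSaxena2024, Thm 1.4] -/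
theorem homImmHardAt_seven_five : HomImmHardAt 7 5 := by
  intro c
  obtain ⟨L₀, hL₀⟩ := BDS.fit c
  exact ⟨2 ^ L₀, fun m hm D hhom hD hpd => homBds_core c hL₀ m hm rfl rfl D hhom hD hpd⟩

/-- **Hard(σ) for every σ ≤ 7/5** (down-set in the slope; the corner `q = 0` forces `p = 0`, i.e. constant depth).
[cite: BhargavDuttaSaxena2024, Thm 1.4, Rem. 1.5] -/
theorem homImmHardAt_of_five_mul_le (p q : ℕ) (h : 5 * p ≤ 7 * q) : HomImmHardAt p q := by
  rcases Nat.eq_zero_or_pos q with rfl | hq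
  · have hp : p = 0 := by omega
    subst hp
    intro c
    obtain ⟨m₀, hm₀⟩ := homImmHardAt_seven_five c
    refine ⟨m₀, fun m hm D hDh hDc hDd => hm₀ m hm D hDh hDc ?_⟩
    simp only [zero_mul, Nat.zero_div, zero_add] at hDd
    omega
  · exact homImmHardAt_seven_five.of_slope_le hq (by norm_num) (by omega)

/-- **The support item `HomImmHardSubReach` of the route `DepthWindow`** (PRINT → KERNEL): `HomImmHardAt p q` at every
slope `5p ≤ 7q`. [cite: BhargavDuttaSaxena2024, Thm 1.4, Rem. 1.5] -/
theorem homImmHardSubReach_bds : HomImmHardSubReach :=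
  homImmHardSubReach_iff.2 fun p q h => homImmHardAt_of_five_mul_le p q h

end

end Summit.ValiantsHypothesis.ValiantsHypothesis.Theorems.DepthWindow
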